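import Literature.Computability.Cryptography.CsidhGeneratorsRayClass
import Literature.Computability.Cryptography.CsidhGeneratorsGrowth
import Literature.NumberTheory.NumberFields.RayClassFieldOfCharacter
import Literature.NumberTheory.NumberFields.TameDifferentCoprimeDegree
import Literature.NumberTheory.LFunctions.PrimeIdealCountSplitPrimes
import Literature.NumberTheory.LFunctions.EffectivePrimeIdealTheoremGRHProofs
import Literature.NumberTheory.QuadraticFields.ClassNumberOddPrime
import Mathlib.Analysis.Fourier.FiniteAbelian.PontryaginDuality
import HarnessLib

/-!
# Small split primes generate `cl(ℤ[√-p])` under ERH: proof of `jmv_smallPrimesGenerate`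

Topic `Computability/Cryptography`; proof file (theorems only, no definition, no named fact)
discharging the named fact `Literature.Computability.Cryptography.Csidh.jmv_smallPrimesGenerate` of
`CsidhGenerators.lean` — Jao–Miller–Venkatesan 2009, Cor. 1.3 with Thm. 1.1, Rem. 1.2(a), Thm. 3.2:
under ERH, for every `B > 2` and all large primes `p ≡ 3 (mod 4)`, the classes of the prime ideals
of prime norm `ℓ ≤ (log 4p)^B` generate `cl(ℤ[√-p]) = ClassGroup (ℤ√-p)`.

## The proof (a deviation from the printed one, recorded)

JMV prove Thm. 1.1 from GRH for the Hecke L-functions of the characters of the (narrow) ray class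
group, through the explicit-formula bound `Σ_{N𝔭 ≤ x} χ(𝔭) log N𝔭 = r x + O(n √x log x log(xQ))`
(Iwaniec–Kowalski, Thm. 5.15) and partial summation. The tree has this GRH bound only for Dedekind
zeta functions — as the effective prime ideal theorem
`|π_K(x) − Li x| ≤ c √x (log|d_K| + [K:ℚ] log x)` under ERH (Lagarias–Odlyzko; Serre 1981 Thm. 4;
`LFunctions.NumberField.effectivePrimeIdealTheorem_of_extendedRiemannHypothesis`, PROVED) — but it
has global class field theory PROVED (Artin reciprocity for characters, Tate's existence theorem in
character form). So we argue by **field counting**, which is JMV's character sum summed over the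
characters of a cyclic quotient: if the small primes generate a proper subgroup `H₀ < G = cl(ℤ[√-p])`,
a nontrivial character `χ` of `G/H₀` (Pontryagin duality), pulled back along
`𝔭 ↦ [𝔭 ∩ ℤ[√-p]]` (`CsidhGeneratorsRayClass`: a ray class character of `K = ℚ(√-p)` mod `(2)`,
JMV Thm. 3.2 / Cox Prop. 7.22), has a class field `E/K` (`RayClassFieldOfCharacter`): Galois of
degree `n ≥ 2`, `n` **odd** (the class number `h(-4p)` is odd, `ClassNumberOddPrime`), unramified
outside `2`, in which every odd prime of `K` of prime norm `ℓ ≤ x = (log 4p)^B` splits completely.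
Counting (`PrimeIdealCountSplitPrimes`): `n (π_K(x) − 4 − 2√x) ≤ π_E(x)`; the effective prime ideal
theorem for `K` and `E`, with `|d_E| ≤ 4^n |d_K|^n` (tame ramification at `2`, as `n` is odd:
`TameDifferentCoprimeDegree`) and `|d_K| ≤ 4p` (`CsidhGeneratorsOrder`), gives
`Li(x) ≤ C (log 4p)^{B/2+1}`, contradicting `C u^{B/2+1} < Li(u^B)` for large `u = log 4p`
(`CsidhGeneratorsGrowth`, the threshold `x = (log q)^B`, `B > 2`, `q = 4p` of JMV Cor. 1.3).

* `exists_quadField` — a model `K : Type` of `ℚ(√-p)` with `ι : ℤ[√-p] → 𝓞 K`, `[K : ℚ] = 2`;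
* `jmv_smallPrimesGenerate_holds` — the discharge.

## References

* [JaoMillerVenkatesan2009] D. Jao, S. D. Miller, R. Venkatesan, *Expander graphs based on GRH with
  an application to elliptic curve cryptography*, J. Number Theory 129 (2009) 1491–1504: Thm. 1.1,
  Rem. 1.2(a), Cor. 1.3, §2 (proofs), Thm. 3.2 (arXiv:0811.0647).
* [Serre1981] J.-P. Serre, Publ. Math. IHÉS 54 (1981), Thm. 4 (effective Chebotarev under GRH).
* [Cox2013] D. A. Cox, *Primes of the form x² + ny²*, 2nd ed. (2013), Prop. 7.22, Thm. 8.2.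
-/

noncomputable section

open scoped Classical nonZeroDivisors NumberField

namespace Literature.Computability.Cryptography.Csidh

open Literature.NumberTheory.QuadraticFields.Quadratic
open Literature.NumberTheory.QuadraticFields.Quadratic.BinQF
open Literature.NumberTheory.LFunctions Literature.NumberTheory.LFunctions.AbelianDensity
open Literature.NumberTheory.LFunctions.NumberField Literature.NumberTheory.NumberFields
open Literature.NumberTheory.GaloisRepresentations
open NumberField Module IsDedekindDomain Polynomial Finset Real

attribute [local instance] isDomain_zsqrtd_neg

/-! ### A model of `ℚ(√-p)` -/

/-- **A model of `K = ℚ(√-p)`**: a number field `K : Type` of degree `2` with a ring homomorphism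
`ι : ℤ[√-p] → 𝓞 K` (`K = ℚ[X]/(X² + p)`, `ι(√-p) = X`). [folklore] -/
theorem exists_quadField (p : ℕ) [Fact p.Prime] :
    ∃ (K : Type) (_ : Field K) (_ : NumberField K) (_ : ℤ√(-(p : ℤ)) →+* 𝓞 K),
      Module.finrank ℚ K = 2 := by
  have hp := (Fact.out : p.Prime)
  set f : ℚ[X] := X ^ 2 + C (p : ℚ) with hf
  have hdeg : f.natDegree = 2 := by
    rw [hf]
    compute_degree!
  have hf0 : f ≠ 0 := by
    intro h
    rw [h, natDegree_zero] at hdeg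
    exact absurd hdeg (by norm_num)
  have hirr : Irreducible f := by
    refine irreducible_of_degree_le_three_of_not_isRoot (by rw [hdeg]; decide) fun x hx => ?_
    rw [IsRoot, hf, eval_add, eval_pow, eval_X, eval_C] at hx
    have hp0 : (0 : ℚ) < p := by exact_mod_cast hp.pos
    nlinarith [sq_nonneg x]
  haveI : Fact (Irreducible f) := ⟨hirr⟩
  -- the root `s` of `f` is integral: `s² = -p`
  have hroot : (AdjoinRoot.root f) ^ 2 = -(p : AdjoinRoot f) := by
    have h := AdjoinRoot.eval₂_root f
    rw [hf, eval₂_add, eval₂_pow, eval₂_X, eval₂_C] at h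
    have e : (AdjoinRoot.of f) (p : ℚ) = (p : AdjoinRoot f) := map_natCast _ _
    rw [e] at h
    linear_combination h
  have hint : IsIntegral ℤ (AdjoinRoot.root f) := by
    refine ⟨X ^ 2 + C (p : ℤ), (monic_X_pow _).add_of_left (by
      rw [degree_C (by exact_mod_cast hp.ne_zero), degree_X_pow]; norm_num), ?_⟩
    rw [eval₂_add, eval₂_pow, eval₂_X, eval₂_C, hroot]
    simp
  set s : 𝓞 (AdjoinRoot f) := ⟨AdjoinRoot.root f, hint⟩ with hs
  have hss : s * s = ((-(p : ℤ) : ℤ) : 𝓞 (AdjoinRoot f)) := by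
    apply RingOfIntegers.coe_injective
    have e1 : algebraMap (𝓞 (AdjoinRoot f)) (AdjoinRoot f) s = AdjoinRoot.root f := rfl
    rw [map_mul, map_intCast, e1, ← sq, hroot]
    push_cast
    ring
  refine ⟨AdjoinRoot f, inferInstance, inferInstance, Zsqrtd.lift ⟨s, hss⟩, ?_⟩
  rw [(AdjoinRoot.powerBasis hf0).finrank, AdjoinRoot.powerBasis_dim, hdeg]

/-! ### Auxiliary: a nontrivial character of a finite abelian group killing a proper subgroup -/

/-- **Pontryagin duality**: a proper subgroup `H` of a finite abelian group `G` is killed by a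
character of `G` which is not identically `1` (a nonzero element of `G/H` is detected by a
character, Mathlib `AddChar.exists_apply_ne_zero`). [folklore] -/
theorem exists_addChar_ne_one_of_ne_top {G : Type*} [CommGroup G] [Finite G] {H : Subgroup G}
    (hH : H ≠ ⊤) :
    ∃ χ : AddChar (Additive G) ℂ, (∀ h ∈ H, toMulHom χ h = 1) ∧ toMulHom χ ≠ 1 := by
  obtain ⟨g, hg⟩ : ∃ g : G, g ∉ H := by
    by_contra hall
    push Not at hall
    exact hH (eq_top_iff.2 fun g _ => hall g)
  haveI : Finite (G ⧸ H) := inferInstance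
  have hq : (Additive.ofMul (QuotientGroup.mk (s := H) g) : Additive (G ⧸ H)) ≠ 0 := by
    intro h0
    apply hg
    have : (QuotientGroup.mk (s := H) g) = 1 := by
      have := congrArg Additive.toMul h0
      simpa using this
    exact (QuotientGroup.eq_one_iff g).1 this
  obtain ⟨ψ, hψ⟩ := (AddChar.exists_apply_ne_zero (α := Additive (G ⧸ H))).2 hq
  refine ⟨ψ.compAddMonoidHom (MonoidHom.toAdditive (QuotientGroup.mk' H)), fun h hh => ?_, fun h1 => ?_⟩
  · have hq1 : (QuotientGroup.mk (s := H) h) = 1 := (QuotientGroup.eq_one_iff h).2 hh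
    simp [toMulHom_apply, hq1]
  · apply hψ
    have := congrArg (fun f : G →* ℂ => f g) h1
    simpa [toMulHom_apply] using this

/-! ### The discharge -/

/-- Elementary: `log 2 ≤ 1`. [folklore] -/
theorem log_two_le_one : Real.log 2 ≤ 1 := by
  have := Real.log_le_sub_one_of_pos (show (0 : ℝ) < 2 by norm_num)
  linarith

/-- **The real-variable endgame.**  If `x = u^B ≥ 2`, `u ≥ 1`, `n ≥ 2`, and the prime-ideal
counts `πK, πE` of two fields of degrees `2, 2n` satisfy the effective prime ideal theorem with
constant `c` and discriminant logarithms `lK ≤ u`, `lE ≤ 2n log 2 + n u`, together with the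
splitting inequality `n (πK - 4 - 2√x) ≤ πE`, then `Li(x) ≤ (8c + 8cB + 12) u^{B/2+1}`.
[folklore] -/
theorem offsetLogIntegral_le_of_counts {B c u x n πK πE lK lE : ℝ} (hB : 2 < B) (hc : 0 < c)
    (hu1 : 1 ≤ u) (hx : x = u ^ B) (hx2 : 2 ≤ x) (hn : 2 ≤ n)
    (hK : |πK - offsetLogIntegral x| ≤ c * Real.sqrt x * (lK + 2 * Real.log x))
    (hE : |πE - offsetLogIntegral x| ≤ c * Real.sqrt x * (lE + 2 * n * Real.log x))
    (hS : n * (πK - 4 - 2 * Real.sqrt x) ≤ πE) (hlK : lK ≤ u)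
    (hlE : lE ≤ 2 * n * Real.log 2 + n * u) :
    offsetLogIntegral x ≤ (8 * c + 8 * c * B + 12) * u ^ (B / 2 + 1) := by
  have hsx0 : 0 ≤ Real.sqrt x := Real.sqrt_nonneg x
  have hL0 : 0 ≤ Real.log x := Real.log_nonneg (by linarith)
  have hlog2 : (0 : ℝ) ≤ Real.log 2 := Real.log_nonneg (by norm_num)
  have hu0 : 0 ≤ u := by linarith
  have hn0 : (0 : ℝ) ≤ n := by linarith
  have hK' : offsetLogIntegral x - c * Real.sqrt x * (lK + 2 * Real.log x) ≤ πK := by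
    have := (abs_sub_le_iff.1 hK).2
    linarith
  have hE' : πE - offsetLogIntegral x ≤ c * Real.sqrt x * (lE + 2 * n * Real.log x) :=
    (abs_sub_le_iff.1 hE).1
  have P1 : n * (offsetLogIntegral x - c * Real.sqrt x * (lK + 2 * Real.log x)) ≤ n * πK :=
    mul_le_mul_of_nonneg_left hK' hn0
  have P2 : c * Real.sqrt x * lE ≤ c * Real.sqrt x * (2 * n * Real.log 2 + n * u) :=
    mul_le_mul_of_nonneg_left hlE (mul_nonneg hc.le hsx0)
  have P3 : n * (c * (Real.sqrt x * lK)) ≤ n * (c * (Real.sqrt x * u)) :=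
    mul_le_mul_of_nonneg_left (mul_le_mul_of_nonneg_left
      (mul_le_mul_of_nonneg_left hlK hsx0) hc.le) hn0
  -- `(n - 1) Li ≤ n Y` with `Y = √x (2cu + 4c log x + 2c log 2 + 2) + 4`
  have hmain : (n - 1) * offsetLogIntegral x ≤
      n * (Real.sqrt x * (2 * c * u + 4 * c * Real.log x + 2 * c * Real.log 2 + 2) + 4) := by
    linarith only [P1, P2, P3, hS, hE']
  have hY0 : 0 ≤ Real.sqrt x * (2 * c * u + 4 * c * Real.log x + 2 * c * Real.log 2 + 2) + 4 := by
    positivity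
  -- `Li ≤ 2 Y` as `n ≥ 2`
  have hLi2 : offsetLogIntegral x ≤
      2 * (Real.sqrt x * (2 * c * u + 4 * c * Real.log x + 2 * c * Real.log 2 + 2) + 4) := by
    have h5 : n * (Real.sqrt x * (2 * c * u + 4 * c * Real.log x + 2 * c * Real.log 2 + 2) + 4) ≤
        (n - 1) * (2 * (Real.sqrt x * (2 * c * u + 4 * c * Real.log x + 2 * c * Real.log 2 + 2) + 4)) := by
      linarith only [mul_nonneg (by linarith only [hn] : (0 : ℝ) ≤ n - 2) hY0]
    exact le_of_mul_le_mul_left (hmain.trans h5) (by linarith)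
  -- `2 Y ≤ C u^{B/2+1}`
  have hsxu : Real.sqrt x = u ^ (B / 2) := by
    rw [hx, Real.sqrt_eq_rpow, ← Real.rpow_mul hu0]
    congr 1
    ring
  have hlogx : Real.log x ≤ B * u := by
    rw [hx, Real.log_rpow (by linarith)]
    have := Real.log_le_sub_one_of_pos (show (0:ℝ) < u by linarith)
    nlinarith
  have hupow' : u ^ (B / 2) * u = u ^ (B / 2 + 1) := by
    rw [Real.rpow_add (by linarith), Real.rpow_one]
  have hupow : 1 ≤ u ^ (B / 2 + 1) := Real.one_le_rpow hu1 (by linarith)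
  have hRHS : 2 * (Real.sqrt x * (2 * c * u + 4 * c * Real.log x + 2 * c * Real.log 2 + 2) + 4) ≤
      (8 * c + 8 * c * B + 12) * u ^ (B / 2 + 1) := by
    rw [hsxu, ← hupow']
    have hub : 0 ≤ u ^ (B / 2) := Real.rpow_nonneg hu0 _
    have q1 : c * Real.log x ≤ c * (B * u) := mul_le_mul_of_nonneg_left hlogx hc.le
    have q2 : c * Real.log 2 ≤ c * u := mul_le_mul_of_nonneg_left (log_two_le_one.trans hu1) hc.le
    have h1 : 2 * c * u + 4 * c * Real.log x + 2 * c * Real.log 2 + 2 ≤ (4 * c + 4 * c * B + 2) * u := by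
      linarith only [q1, q2, hu1]
    have q3 : u ^ (B / 2) * (2 * c * u + 4 * c * Real.log x + 2 * c * Real.log 2 + 2) ≤
        u ^ (B / 2) * ((4 * c + 4 * c * B + 2) * u) := mul_le_mul_of_nonneg_left h1 hub
    have h4 : (1 : ℝ) ≤ u ^ (B / 2) * u := by rw [hupow']; exact hupow
    have h5 : 0 ≤ c * (u ^ (B / 2) * u) := mul_nonneg hc.le (mul_nonneg hub hu0)
    have h6 : 0 ≤ c * B * (u ^ (B / 2) * u) :=
      mul_nonneg (mul_nonneg hc.le (by linarith)) (mul_nonneg hub hu0)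
    linarith only [q3, h4, h5, h6, mul_nonneg hub hu0]
  exact hLi2.trans hRHS

-- a long assembly (class field, counting, two prime ideal theorems) in one declaration
set_option maxHeartbeats 800000 in
/-- **Jao–Miller–Venkatesan, Cor. 1.3 (generation, for `cl(ℤ[√-p])`) holds**: under ERH, for every
`B > 2` there is `P₀` such that for every prime `p ≥ P₀` with `p ≡ 3 (mod 4)`, the classes of the
prime ideals `(ℓ, t + √-p)`, `ℓ` an odd prime `≤ (log 4p)^B`, generate `ClassGroup (ℤ√-p)`. See
the module docstring for the proof (field counting with the tree's class field theory and
effective prime ideal theorem in place of JMV's character sums).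
[cite: JaoMillerVenkatesan2009, Cor. 1.3 with Thm. 1.1, Rem. 1.2(a), Thm. 3.2] -/
theorem jmv_smallPrimesGenerate_holds : jmv_smallPrimesGenerate := by
  intro hERH B hB
  obtain ⟨c, hc, hPIT⟩ := effectivePrimeIdealTheorem_of_extendedRiemannHypothesis hERH
  set C : ℝ := 8 * c + 8 * c * B + 12 with hCdef
  obtain ⟨P₀, hP₀⟩ :=
    exists_nat_forall_mul_rpow_log_lt_offsetLogIntegral hB C (a := 4) (by norm_num)
  refine ⟨P₀, fun p _ hp hp4 => ?_⟩
  have hpr : (Fact.out : p.Prime) = Fact.out := rfl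
  have hpp : p.Prime := Fact.out
  obtain ⟨hgrowth, hu1, hx2⟩ := hP₀ p hp
  set u : ℝ := Real.log (4 * p) with hudef
  set x : ℝ := u ^ B with hxdef
  by_contra hne
  -- the group `G = cl(ℤ[√-p])`: finite of odd order `N`
  set G := ClassGroup (ℤ√(-(p : ℤ)))
  have hodd : Odd (Nat.card (ClassGroup (ℤ√(-(p : ℤ))))) := odd_card_classGroup_neg_prime hpp hp4
  have hN0 : Nat.card (ClassGroup (ℤ√(-(p : ℤ)))) ≠ 0 := fun h => by
    rw [h] at hodd; exact Nat.not_odd_zero hodd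
  haveI : Finite (ClassGroup (ℤ√(-(p : ℤ)))) := Nat.finite_of_card_ne_zero hN0
  set N := Nat.card (ClassGroup (ℤ√(-(p : ℤ)))) with hNdef
  -- a nontrivial character killing the small primes
  set H₀ := Subgroup.closure (smallPrimeClasses p (Real.log (4 * p) ^ B)) with hH₀
  obtain ⟨χa, hχH, hχne⟩ := exists_addChar_ne_one_of_ne_top (H := H₀) hne
  -- the field `K = ℚ(√-p)` and the ray class character
  obtain ⟨K, _, _, ι, h2⟩ := exists_quadField p
  set Φ : HeightOneSpectrum (𝓞 K) → ClassGroup (ℤ√(-(p : ℤ))) :=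
    fun v => classOf p (v.asIdeal.comap ι) with hΦdef
  have hΦ : ∀ v, Φ v = classOf p (v.asIdeal.comap ι) := fun v => rfl
  set ψ : HeightOneSpectrum (𝓞 K) → ℂ := fun v => toMulHom χa (Φ v) with hψdef
  have hray : IsRayClassCharacter (Ideal.span {(2 : 𝓞 K)}) ψ :=
    isRayClassCharacter_toMulHom_comp p ι Φ h2 hΦ χa
  have h𝔣 : Ideal.span {(2 : 𝓞 K)} ≠ ⊥ := by
    rw [Ne, Ideal.span_singleton_eq_bot]
    exact two_ne_zero
  have hmem2 : ∀ v : HeightOneSpectrum (𝓞 K), ¬ Ideal.span {(2 : 𝓞 K)} ≤ v.asIdeal ↔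
      (2 : 𝓞 K) ∉ v.asIdeal := fun v => by
    rw [Ideal.span_le, Set.singleton_subset_iff, SetLike.mem_coe]
  obtain ⟨E, hEfd, hEgal, hunr, hsplit, hexp, hnontriv⟩ :=
    exists_classField_of_isRayClassCharacter h𝔣 hray
  haveI := hEfd
  haveI := hEgal
  haveI : NumberField E := NumberField.of_module_finite K E
  -- the degree `n = [E : K]` is odd and `≥ 2`
  set n := Module.finrank K E with hndef
  have hnodd : Odd n := by
    refine odd_finrank_of_forall_pow_eq_one E hodd (hexp N fun v _ => ?_)
    rw [hψdef]
    simp only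
    rw [← map_pow, pow_card_eq_one', map_one]
  have hn2 : 2 ≤ n := by
    refine hnontriv ?_
    obtain ⟨v, h2v, hv⟩ := exists_apply_ne_one_of_ne_one p ι Φ h2 hΦ (toMulHom χa) hχne
    exact ⟨v, (hmem2 v).2 h2v, hv⟩
  -- unramified outside `2`, in the form of the discriminant bound
  have hunr' : ∀ (𝔔 : Ideal (𝓞 E)) [𝔔.IsMaximal], (2 : 𝓞 E) ∉ 𝔔 →
      Algebra.IsUnramifiedAt (𝓞 K) 𝔔 := by
    intro 𝔔 h𝔔 h2𝔔
    have h𝔔0 : 𝔔 ≠ ⊥ := Ring.ne_bot_of_isMaximal_of_not_isField h𝔔 (RingOfIntegers.not_isField E)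
    set v : HeightOneSpectrum (𝓞 K) :=
      ⟨𝔔.under (𝓞 K), inferInstance, mt Ideal.eq_bot_of_comap_eq_bot h𝔔0⟩
    have h2v : (2 : 𝓞 K) ∉ v.asIdeal := by
      intro h
      apply h2𝔔
      have : algebraMap (𝓞 K) (𝓞 E) 2 ∈ 𝔔 := Ideal.mem_comap.1 h
      rwa [map_ofNat] at this
    exact hunr v ((hmem2 v).2 h2v) 𝔔 h𝔔.isPrime ⟨rfl⟩
  have hcop : Nat.Coprime 2 n := Nat.coprime_two_left.2 hnodd
  have hdiscE := natAbs_discr_le_of_coprime_of_unramified (K := K) (L := E) Nat.prime_two hcop hunr'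
  have hdiscK := natAbs_discr_le_four_mul p ι h2
  have hrankE : Module.finrank ℚ E = 2 * n := by
    rw [← Module.finrank_mul_finrank ℚ K E, h2]
  -- counting: `n · #{odd split degree-one primes} ≤ π_E(x)` and `π_K(x) ≤ # + 4 + 2√x`
  have hx0 : (0 : ℝ) ≤ x := by linarith
  set S : ℕ := ∑ ℓ ∈ ((Icc 0 ⌊x⌋₊).filter Nat.Prime).filter (fun ℓ => ℓ ≠ 2), idealNormCount K ℓ
    with hSdef
  have hcountE : n * S ≤ primeIdealCount E x := by
    have h1 : n * S ≤ ∑ ℓ ∈ ((Icc 0 ⌊x⌋₊).filter Nat.Prime).filter (fun ℓ => ℓ ≠ 2),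
        idealNormCount E ℓ := by
      rw [hSdef, mul_sum]
      refine sum_le_sum fun ℓ hℓ => ?_
      -- `n c_K(ℓ) ≤ c_E(ℓ)` for odd primes `ℓ ≤ x`
      rw [mem_filter, mem_filter, mem_Icc] at hℓ
      obtain ⟨⟨⟨-, hℓx⟩, hℓp⟩, hℓ2⟩ := hℓ
      refine mul_idealNormCount_le_of_forall_primesOver K E hℓp fun 𝔮 h𝔮 => ?_
      have h𝔮p : 𝔮.IsPrime := Ideal.isPrime_of_irreducible_absNorm
        (h𝔮 ▸ (Nat.irreducible_iff_nat_prime ℓ).mpr hℓp)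
      have h𝔮0 : 𝔮 ≠ ⊥ := by
        intro h0; rw [h0, Ideal.absNorm_bot] at h𝔮; exact hℓp.ne_zero h𝔮.symm
      set v : HeightOneSpectrum (𝓞 K) := ⟨𝔮, h𝔮p, h𝔮0⟩
      have h2v : (2 : 𝓞 K) ∉ v.asIdeal := by
        intro h2
        have hℓv : (ℓ : 𝓞 K) ∈ 𝔮 := by have := Ideal.absNorm_mem 𝔮; rwa [h𝔮] at this
        obtain ⟨k, hk⟩ := hℓp.odd_of_ne_two hℓ2
        have h1 : (1 : 𝓞 K) = ℓ - k * 2 := by rw [hk]; push_cast; ring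
        exact h𝔮p.ne_top ((Ideal.eq_top_iff_one _).2 (h1 ▸ 𝔮.sub_mem hℓv (𝔮.mul_mem_left _ h2)))
      have hℓxR : (ℓ : ℝ) ≤ Real.log (4 * p) ^ B := by
        have : (ℓ : ℝ) ≤ ⌊x⌋₊ := by exact_mod_cast hℓx
        exact this.trans (Nat.floor_le hx0)
      have hΦv : Φ v ∈ H₀ := Subgroup.subset_closure
        (apply_mem_smallPrimeClasses p ι Φ hΦ v h2v hℓp h𝔮 hℓxR)
      have hψv : ψ v = 1 := hχH _ hΦv
      have hvs : v ∈ splitPrimes K E := hsplit v ((hmem2 v).2 h2v) hψv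
      exact ⟨(ncard_primesOver_of_mem_splitPrimes hvs).ge,
        fun 𝔔 h𝔔 => (absNorm_eq_of_mem_splitPrimes hvs h𝔔).trans h𝔮⟩
    have h2' : ∑ ℓ ∈ ((Icc 0 ⌊x⌋₊).filter Nat.Prime).filter (fun ℓ => ℓ ≠ 2), idealNormCount E ℓ ≤
        ∑ ℓ ∈ (Icc 0 ⌊x⌋₊).filter Nat.Prime, idealNormCount E ℓ :=
      sum_le_sum_of_subset_of_nonneg (filter_subset _ _) fun _ _ _ => Nat.zero_le _
    exact h1.trans (h2'.trans (sum_idealNormCount_prime_le_primeIdealCount E hx0))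
  have hcountK : primeIdealCount K x ≤ S + 4 + 2 * Nat.sqrt ⌊x⌋₊ := by
    have h1 := primeIdealCount_le_sum_idealNormCount_add_real K hx0
    rw [h2] at h1
    have hsum : ∑ ℓ ∈ (Icc 0 ⌊x⌋₊).filter Nat.Prime, idealNormCount K ℓ ≤ S + 2 := by
      rw [← sum_filter_add_sum_filter_not ((Icc 0 ⌊x⌋₊).filter Nat.Prime) (fun ℓ => ℓ ≠ 2), ← hSdef]
      refine Nat.add_le_add_left ?_ S
      calc ∑ ℓ ∈ ((Icc 0 ⌊x⌋₊).filter Nat.Prime).filter (fun ℓ => ¬ ℓ ≠ 2), idealNormCount K ℓ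
          ≤ ∑ ℓ ∈ ({2} : Finset ℕ), idealNormCount K ℓ :=
            sum_le_sum_of_subset_of_nonneg (fun ℓ hℓ => by
              rw [mem_filter] at hℓ; rw [mem_singleton]; simpa using hℓ.2)
              fun _ _ _ => Nat.zero_le _
        _ = idealNormCount K 2 := sum_singleton _ _
        _ ≤ 2 := by have := idealNormCount_prime_le_finrank K Nat.prime_two; rwa [h2] at this
    have hπ : Nat.primeCounting (Nat.sqrt ⌊x⌋₊) ≤ Nat.sqrt ⌊x⌋₊ + 1 := by
      rw [Nat.primeCounting, Nat.primeCounting']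
      exact Nat.count_le Nat.Prime
    calc primeIdealCount K x ≤ _ := h1
      _ ≤ (S + 2) + 2 * (Nat.sqrt ⌊x⌋₊ + 1) := Nat.add_le_add hsum (Nat.mul_le_mul_left 2 hπ)
      _ = S + 4 + 2 * Nat.sqrt ⌊x⌋₊ := by ring
  -- the effective prime ideal theorem for `K` and `E`
  have hPITK := hPIT K x hx2
  have hPITE := hPIT E x hx2
  rw [h2] at hPITK
  rw [hrankE] at hPITE
  -- real-number bookkeeping
  have hn : (2 : ℝ) ≤ n := by exact_mod_cast hn2
  have hsqrt_nat : (Nat.sqrt ⌊x⌋₊ : ℝ) ≤ Real.sqrt x := by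
    have h1 : ((Nat.sqrt ⌊x⌋₊ : ℕ) : ℝ) ^ 2 ≤ ⌊x⌋₊ := by exact_mod_cast Nat.sqrt_le' ⌊x⌋₊
    have h2' : ((Nat.sqrt ⌊x⌋₊ : ℕ) : ℝ) ^ 2 ≤ x := h1.trans (Nat.floor_le hx0)
    exact Real.le_sqrt_of_sq_le h2'
  have hSx : (n : ℝ) * ((primeIdealCount K x : ℝ) - 4 - 2 * Real.sqrt x) ≤ (primeIdealCount E x : ℝ) := by
    have h1 : (n : ℝ) * (S : ℝ) ≤ (primeIdealCount E x : ℝ) := by exact_mod_cast hcountE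
    have h2' : (primeIdealCount K x : ℝ) ≤ S + 4 + 2 * (Nat.sqrt ⌊x⌋₊ : ℝ) := by
      exact_mod_cast hcountK
    nlinarith
  -- discriminants
  have hdK1 : (1 : ℝ) ≤ |(NumberField.discr K : ℝ)| := by
    have := NumberField.discr_ne_zero K
    have h1 : (1 : ℤ) ≤ |NumberField.discr K| := Int.one_le_abs this
    exact_mod_cast h1
  have hdE1 : (1 : ℝ) ≤ |(NumberField.discr E : ℝ)| := by
    have := NumberField.discr_ne_zero E
    have h1 : (1 : ℤ) ≤ |NumberField.discr E| := Int.one_le_abs this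
    exact_mod_cast h1
  have hp0 : (0 : ℝ) < p := by exact_mod_cast hpp.pos
  have hlK : Real.log |(NumberField.discr K : ℝ)| ≤ u := by
    rw [hudef]
    refine Real.log_le_log (by linarith) ?_
    have : ((NumberField.discr K).natAbs : ℝ) ≤ 4 * p := by exact_mod_cast hdiscK
    rwa [Nat.cast_natAbs, Int.cast_abs] at this
  have hlE : Real.log |(NumberField.discr E : ℝ)| ≤ 2 * n * Real.log 2 + n * u := by
    have h1 : ((NumberField.discr E).natAbs : ℝ) ≤
        (2 : ℝ) ^ (2 * n) * ((NumberField.discr K).natAbs : ℝ) ^ n := by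
      rw [← hrankE]; exact_mod_cast hdiscE
    rw [Nat.cast_natAbs, Int.cast_abs, Nat.cast_natAbs, Int.cast_abs] at h1
    calc Real.log |(NumberField.discr E : ℝ)|
        ≤ Real.log ((2 : ℝ) ^ (2 * n) * |(NumberField.discr K : ℝ)| ^ n) :=
          Real.log_le_log (by linarith) h1
      _ = 2 * n * Real.log 2 + n * Real.log |(NumberField.discr K : ℝ)| := by
          rw [Real.log_mul (by positivity) (by positivity), Real.log_pow, Real.log_pow]
          push_cast
          ring
      _ ≤ 2 * n * Real.log 2 + n * u := by nlinarith [hlK]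
  -- the endgame
  push_cast at hPITK hPITE
  have hfinal := offsetLogIntegral_le_of_counts hB hc hu1 hxdef hx2 hn hPITK hPITE hSx hlK hlE
  rw [← hCdef] at hfinal
  linarith

end Literature.Computability.Cryptography.Csidh

end
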